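import Literature.Analysis.FluidPDE.LeiRenZhangSwirlEnergyIdentity
import Literature.Analysis.FluidPDE.LeiRenZhangSwirlWeights
import Literature.Analysis.FluidPDE.LeiRenZhangSwirlEstimates
import HarnessLib

/-!
# Lei–Ren–Zhang 2019, Theorem 1.2: the rate condition with a non-zero limit is impossible

Analysis/FluidPDE proof file (no definitions, no named facts, no `sorry`) on the discharge path of
the named fact `Literature.Analysis.FluidPDE.leiRenZhang2019_liouville_swirl_rate` (Z. Lei,
X. Ren, Q. S. Zhang, *On ancient periodic solutions to axially-symmetric Navier–Stokes
equations*, arXiv:1902.11229, Theorem 1.2 (p. 4), proof in §4 (pp. 10–12)).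

The heart of the printed proof: "We will prove that `lim sup_{r→∞} Γ = 0` uniformly in `t` and
`z` … Suppose for contradiction that [this] is false. Then `lim sup |Γ| = c₀ ≠ 0` … [weighted
energy estimate (4.4)–(4.14)] … inequality (4.14) is impossible when `R` is sufficiently large and
`T ≫ R₀ r₀`, `R₀ ≫ r₀` and `ε` is sufficiently small." This file proves that statement for the
swirl `f = Γ` of the smooth representative of a bounded ancient solution, in the class in which
the tree delivers the swirl equation (KNSS 2009, (5.10), time-integrated off the axis, bounded
divergence-free drift `b` with radial component `|b_r| ≤ M`):

* `swirl_rate_energy_ineq`: the weighted energy identity (`swirl_energy_spaceTime_identity`) for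
  the weight `Ψ = χ_R w_{r₀}` (`LeiRenZhangSwirlWeights`) and the time profile
  `ζ(s) = (−1 − s)/T` on `(−1 − T, −1]`, rearranged: the axis source `c₂ L² (2R) T` is bounded by
  the junk, time and initial terms ((4.4)–(4.7): `L ≤ −RT/6 + …`);
* `swirl_rate_junk_le`, `swirl_rate_time_le`, `swirl_rate_initial_le`: the bounds of those terms
  through the envelope `e(r)` of `|Γ² − L²|` given by the rate hypothesis
  (`LeiRenZhangSwirlEstimates`) — (4.8)–(4.13);
* `swirl_rate_contradiction`: **if `|Γ² − L²| ≤ ε L²/r` for `r ≥ R₀`, uniformly in `z` and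
  `t < 0`, with `ε (M + 1) ≤ 1/16` and `L ≠ 0`, then `False`** (Step 6, p. 12).

The rendering simplifies the printed bookkeeping in two inessential ways, recorded here: the
weight `λ(r) dr dz` of (4.3) is replaced by the smooth Cartesian weight
`w_{r₀} = r₀²/(r₀² + r²)` (equal to `1` on the axis and decaying, which is all the argument uses),
and the auxiliary backward parabolic cut-off `φ₂` of Step 2 on the outer region `D₂` is not
needed: with the rate hypothesis available for all `r ≥ R₀`, an explicit cut-off `χ_R` makes every
outer term `O(T log R) + O(R)`, whereas the axis source is of order `RT` (the printed `−RT/6`).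
The "first observation" `sup |Γ| = lim sup_{r→∞} |Γ|` of p. 10 is likewise not needed: the terms
it signs (`T₁₇`, `T₄₇`) are `O(R)`.

## References

* Z. Lei, X. Ren, Q. S. Zhang, arXiv:1902.11229, Theorem 1.2 (p. 4), §4 Steps 1–6,
  (4.1)–(4.14) (pp. 10–12). [LeiRenZhang2019]
* G. Koch, N. Nadirashvili, G. Seregin, V. Šverák, Acta Math. 203 (2009) = arXiv:0709.3599,
  (5.10) (p. 10). [KochNadirashviliSereginSverak2009]
-/

noncomputable section

open MeasureTheory Set Function Filter Topology TopologicalSpace InnerProductSpace WithLp Metric Real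
open scoped Laplacian RealInnerProductSpace ContDiff

namespace Literature.Analysis.FluidPDE

/-! ### The time profile `ζ(s) = (−1 − s)/T` on `(−1 − T, −1]` -/

section Profile

/-- The time profile `ζ(s) = (−1 − s)/T` is `C¹` with derivative `−1/T`, vanishes at the final
time `−1`, equals `1` at `−1 − T`, takes values in `[0, 1]` on `(−1 − T, −1]`, and
`∫_{(−1−T,−1]} ζ = T/2` (Lei–Ren–Zhang 2019, §4 Step 2: `φ₁ = ξ₁(z) t/(−T)`, here translated to
end at `t = −1`). [cite: LeiRenZhang2019, §4 Step 2 (arXiv p. 10)] -/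
theorem timeProfile_props {T : ℝ} (hT : 0 < T) :
    ContDiff ℝ 1 (fun s : ℝ => (-1 - s) / T) ∧
    (deriv (fun s : ℝ => (-1 - s) / T) = fun _ => -(1 / T)) ∧
    (fun s : ℝ => (-1 - s) / T) (-1) = 0 ∧ (fun s : ℝ => (-1 - s) / T) (-1 - T) = 1 ∧
    (∀ s ∈ Ioc (-1 - T) (-1), 0 ≤ (-1 - s) / T ∧ (-1 - s) / T ≤ 1) ∧
    IntegrableOn (fun s : ℝ => (-1 - s) / T) (Ioc (-1 - T) (-1)) ∧
    ∫ s in Ioc (-1 - T) (-1), (-1 - s) / T = T / 2 := by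
  have hd : ∀ s, HasDerivAt (fun s : ℝ => (-1 - s) / T) (-(1 / T)) s := fun s => by
    have := ((hasDerivAt_id s).const_sub (-1)).div_const T
    refine this.congr_deriv ?_
    ring
  have hcd : ContDiff ℝ 1 (fun s : ℝ => (-1 - s) / T) := (contDiff_const.sub contDiff_id).div_const T
  have h1 : (fun s : ℝ => (-1 - s) / T) (-1 - T) = 1 := by
    show (-1 - (-1 - T)) / T = 1
    rw [show (-1 - (-1 - T)) = T by ring]
    exact div_self hT.ne'
  refine ⟨hcd, funext fun s => (hd s).deriv, by simp, h1, fun s hs => ⟨?_, ?_⟩, ?_, ?_⟩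
  · exact div_nonneg (by linarith [hs.2]) hT.le
  · rw [div_le_one hT]; linarith [hs.1]
  · exact (hcd.continuous.integrableOn_Icc (a := -1 - T) (b := -1)).mono_set Ioc_subset_Icc_self
  · have hF : ∀ s ∈ uIcc (-1 - T) (-1), HasDerivAt (fun s : ℝ => -((-1 - s) ^ 2) / (2 * T)) ((-1 - s) / T) s := by
      intro s _
      have h1 : HasDerivAt (fun s : ℝ => (-1 - s) ^ 2) (2 * (-1 - s) * (-1)) s := by
        have := ((hasDerivAt_id s).const_sub (-1)).fun_pow 2
        refine this.congr_deriv ?_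
        simp
      have h2 := (h1.neg).div_const (2 * T)
      refine h2.congr_deriv ?_
      have hT0 : T ≠ 0 := hT.ne'
      field_simp
    rw [← intervalIntegral.integral_of_le (by linarith),
      intervalIntegral.integral_eq_sub_of_hasDerivAt hF (hcd.continuous.intervalIntegrable _ _)]
    field_simp
    ring

end Profile

/-! ### The energy inequality for the weight `χ_R w_{r₀}` -/

section EnergyIneq

variable {f : ℝ → EuclideanSpace ℝ (Fin 3) → ℝ} {b : ℝ → EuclideanSpace ℝ (Fin 3) → EuclideanSpace ℝ (Fin 3)}
  {Cb T R r₀ L : ℝ}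

set_option maxHeartbeats 1600000 in
/-- **The weighted energy identity for `Ψ = χ_R w_{r₀}`, `ζ(s) = (−1 − s)/T`, rearranged**
(Lei–Ren–Zhang 2019, §4, (4.4)–(4.7): "`L ≡ ∫ |∇Γ|² φ² dμ dt = T₁ + ⋯ + T₆`", with the axis term
`T₂ ≤ −RT/6 + ⋯` isolated). Writing `G = f² − L²`, the identity
`swirl_energy_spaceTime_identity` with `c = L²`, the axis source
`∫ (2/r) ∂ᵣΨ dx = −2c₂ ∫ Ψ(0,0,z) dz ≤ −4 c₂ R` (`integral_two_div_cylRadius_mul_fderiv_eR_eq`,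
`Ψ = χ_R` on the axis), `∫ ζ = T/2`, `ζ(−1) = 0`, `ζ(−1 − T) = 1`, `ζ' = −1/T` and the
non-negativity of the dissipation give
`c₂ L² (2R) T ≤ |∫∫ ζ G (ΔΨ + DΨ[b] + (2/r)∂ᵣΨ)| + |∫∫ (1/T) G Ψ| + |∫ G(−1−T) Ψ dx|`,
the three integrands being integrable. [cite: LeiRenZhang2019, §4 (4.4)–(4.7) (arXiv pp. 10–11)] -/
theorem swirl_rate_energy_ineq (hT : 0 < T) (hR : 0 < R) (hr₀ : 0 < r₀)
    (hf : ∀ t < 0, ContDiff ℝ 2 (f t))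
    (hfc : ContinuousOn (uncurry f) (Iio 0 ×ˢ univ))
    (hfD : ContinuousOn (fun p : ℝ × EuclideanSpace ℝ (Fin 3) => fderiv ℝ (f p.1) p.2) (Iio 0 ×ˢ univ))
    (hfΔ : ContinuousOn (fun p : ℝ × EuclideanSpace ℝ (Fin 3) => (Δ (f p.1)) p.2) (Iio 0 ×ˢ univ))
    (hax : ∀ t < 0, IsAxisymmetricScalar (f t))
    (h0 : ∀ t < 0, ∀ x, cylRadius x = 0 → f t x = 0)
    (hbm : Measurable (uncurry b))
    (hb1 : ∀ t < 0, ContDiff ℝ 1 (b t)) (hbdiv : ∀ t < 0, VectorCalculus.IsDivFree (b t))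
    (hbB : ∀ t < 0, ∀ x, ‖b t x‖ ≤ Cb)
    (heq : ∀ x, cylRadius x ≠ 0 → ∀ s t : ℝ, s ≤ t → t < 0 →
      f t x - f s x = ∫ τ in s..t, swirlEqnIntegrand f b τ x) :
    Integrable (fun p : ℝ × EuclideanSpace ℝ (Fin 3) => (-1 - p.1) / T *
        ((f p.1 p.2 * f p.1 p.2 - L ^ 2) *
          (Δ (fun y : EuclideanSpace ℝ (Fin 3) => Real.smoothTransition (2 - ‖y‖ ^ 2 / R ^ 2) ^ 2 *
              (r₀ ^ 2 / (r₀ ^ 2 + (y 0 ^ 2 + y 1 ^ 2)))) p.2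
          + fderiv ℝ (fun y : EuclideanSpace ℝ (Fin 3) => Real.smoothTransition (2 - ‖y‖ ^ 2 / R ^ 2) ^ 2 *
              (r₀ ^ 2 / (r₀ ^ 2 + (y 0 ^ 2 + y 1 ^ 2)))) p.2 (b p.1 p.2)
          + 2 / cylRadius p.2 * fderiv ℝ (fun y : EuclideanSpace ℝ (Fin 3) =>
              Real.smoothTransition (2 - ‖y‖ ^ 2 / R ^ 2) ^ 2 * (r₀ ^ 2 / (r₀ ^ 2 + (y 0 ^ 2 + y 1 ^ 2)))) p.2 (eR p.2))))
      ((volume.restrict (Ioc (-1 - T) (-1))).prod (volume : Measure (EuclideanSpace ℝ (Fin 3)))) ∧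
    Integrable (fun p : ℝ × EuclideanSpace ℝ (Fin 3) => 1 / T * ((f p.1 p.2 * f p.1 p.2 - L ^ 2) *
        (Real.smoothTransition (2 - ‖p.2‖ ^ 2 / R ^ 2) ^ 2 * (r₀ ^ 2 / (r₀ ^ 2 + (p.2 0 ^ 2 + p.2 1 ^ 2))))))
      ((volume.restrict (Ioc (-1 - T) (-1))).prod (volume : Measure (EuclideanSpace ℝ (Fin 3)))) ∧
    Integrable (fun y : EuclideanSpace ℝ (Fin 3) => (f (-1 - T) y * f (-1 - T) y - L ^ 2) *
        (Real.smoothTransition (2 - ‖y‖ ^ 2 / R ^ 2) ^ 2 * (r₀ ^ 2 / (r₀ ^ 2 + (y 0 ^ 2 + y 1 ^ 2))))) ∧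
    radialConst₂ * L ^ 2 * (2 * R) * T ≤
      |∫ p, (-1 - p.1) / T *
        ((f p.1 p.2 * f p.1 p.2 - L ^ 2) *
          (Δ (fun y : EuclideanSpace ℝ (Fin 3) => Real.smoothTransition (2 - ‖y‖ ^ 2 / R ^ 2) ^ 2 *
              (r₀ ^ 2 / (r₀ ^ 2 + (y 0 ^ 2 + y 1 ^ 2)))) p.2
          + fderiv ℝ (fun y : EuclideanSpace ℝ (Fin 3) => Real.smoothTransition (2 - ‖y‖ ^ 2 / R ^ 2) ^ 2 *
              (r₀ ^ 2 / (r₀ ^ 2 + (y 0 ^ 2 + y 1 ^ 2)))) p.2 (b p.1 p.2)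
          + 2 / cylRadius p.2 * fderiv ℝ (fun y : EuclideanSpace ℝ (Fin 3) =>
              Real.smoothTransition (2 - ‖y‖ ^ 2 / R ^ 2) ^ 2 * (r₀ ^ 2 / (r₀ ^ 2 + (y 0 ^ 2 + y 1 ^ 2)))) p.2 (eR p.2)))
        ∂((volume.restrict (Ioc (-1 - T) (-1))).prod (volume : Measure (EuclideanSpace ℝ (Fin 3))))|
      + |∫ p, 1 / T * ((f p.1 p.2 * f p.1 p.2 - L ^ 2) *
          (Real.smoothTransition (2 - ‖p.2‖ ^ 2 / R ^ 2) ^ 2 * (r₀ ^ 2 / (r₀ ^ 2 + (p.2 0 ^ 2 + p.2 1 ^ 2)))))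
        ∂((volume.restrict (Ioc (-1 - T) (-1))).prod (volume : Measure (EuclideanSpace ℝ (Fin 3))))|
      + |∫ y, (f (-1 - T) y * f (-1 - T) y - L ^ 2) *
          (Real.smoothTransition (2 - ‖y‖ ^ 2 / R ^ 2) ^ 2 * (r₀ ^ 2 / (r₀ ^ 2 + (y 0 ^ 2 + y 1 ^ 2))))| := by
  have hab : (-1 - T : ℝ) ≤ -1 := by linarith
  have hb0 : (-1 : ℝ) < 0 := by norm_num
  have hc₂ := radialConst₂_pos
  -- the weight and the profile
  obtain ⟨hP2, hPc, hPa, hP01⟩ := productWeight_props (r₀ := r₀) (R := R) hr₀ hR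
  obtain ⟨hζcd, hζd, hζ_end, hζ_start, hζ01, hζi, hζint⟩ := timeProfile_props hT
  have hP1 := hP2.of_le (show (1 : WithTop ℕ∞) ≤ 2 by norm_num)
  have hPint : Integrable (fun y : EuclideanSpace ℝ (Fin 3) => Real.smoothTransition (2 - ‖y‖ ^ 2 / R ^ 2) ^ 2 *
      (r₀ ^ 2 / (r₀ ^ 2 + (y 0 ^ 2 + y 1 ^ 2)))) (volume : Measure (EuclideanSpace ℝ (Fin 3))) :=
    hP2.continuous.integrable_of_hasCompactSupport hPc
  -- the identity
  have hE := swirl_energy_spaceTime_identity hab hb0 hf hfc hfD hfΔ hax h0 hbm hb1 hbdiv hbB heq hP2 hPc hPa hζcd (L ^ 2)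
  -- the integrable pieces
  have i2 := integrable_slab_laplacian (a := -1 - T) hb0 hfc hfD hfΔ hP2 hPc hζcd (L ^ 2)
  have i3 := integrable_slab_transport (a := -1 - T) hb0 hfc hfD hfΔ hbm hbB hP2 hPc hζcd (L ^ 2)
  have i4 := integrable_slab_axis (a := -1 - T) hb0 hfc hfD hfΔ hP2 hPc hζcd
  have i5 := integrable_slab_timeDeriv (a := -1 - T) hb0 hfc hfD hfΔ hP2 hPc hζcd
  -- the axis source
  obtain ⟨hAxI, hprofI, hAxVal⟩ := integral_two_div_cylRadius_mul_fderiv_eR_eq hP1 hPc hPa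
  -- fold the weight
  set P : EuclideanSpace ℝ (Fin 3) → ℝ := fun y => Real.smoothTransition (2 - ‖y‖ ^ 2 / R ^ 2) ^ 2 *
    (r₀ ^ 2 / (r₀ ^ 2 + (y 0 ^ 2 + y 1 ^ 2))) with hPdef
  set μ : Measure (ℝ × EuclideanSpace ℝ (Fin 3)) := (volume.restrict (Ioc (-1 - T) (-1))).prod volume with hμdef
  set A : ℝ := ∫ z : ℝ, P (meridianPoint (0, z)) with hA
  have hprof : (fun z : ℝ => P (meridianPoint (0, z))) =
      fun z => Real.smoothTransition (2 - ‖meridianPoint (0, z)‖ ^ 2 / R ^ 2) ^ 2 := by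
    funext z
    exact productWeight_meridianPoint_axis (R := R) hr₀ z
  have hA2R : 2 * R ≤ A := by
    rw [hA, hprof]
    rw [hprof] at hprofI
    exact two_mul_le_integral_sqBallCutoff_axis hR hprofI
  have iax1 : Integrable (fun p : ℝ × EuclideanSpace ℝ (Fin 3) => (-1 - p.1) / T * (2 / cylRadius p.2 * fderiv ℝ P p.2 (eR p.2))) μ :=
    Integrable.mul_prod (f := fun s : ℝ => (-1 - s) / T) hζi hAxI
  have vax1 : ∫ p, (-1 - p.1) / T * (2 / cylRadius p.2 * fderiv ℝ P p.2 (eR p.2)) ∂μ = (T / 2) * (-(2 * radialConst₂) * A) := by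
    rw [hμdef, integral_prod_mul (μ := volume.restrict (Ioc (-1 - T) (-1))) (ν := (volume : Measure (EuclideanSpace ℝ (Fin 3))))
      (fun s : ℝ => (-1 - s) / T) (fun x => 2 / cylRadius x * fderiv ℝ P x (eR x))]
    rw [hζint, hAxVal]
  -- the `G`-part of the axis term
  have iaxG : Integrable (fun p : ℝ × EuclideanSpace ℝ (Fin 3) => (-1 - p.1) / T *
      (2 / cylRadius p.2 * ((f p.1 p.2 * f p.1 p.2 - L ^ 2) * fderiv ℝ P p.2 (eR p.2)))) μ := by
    refine (i4.sub (iax1.const_mul (L ^ 2))).congr (Eventually.of_forall fun p => ?_)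
    simp only [Pi.sub_apply]
    ring
  have vaxG : ∫ p, (-1 - p.1) / T * (2 / cylRadius p.2 * ((f p.1 p.2 * f p.1 p.2 - L ^ 2) * fderiv ℝ P p.2 (eR p.2))) ∂μ =
      (∫ p, (-1 - p.1) / T * (2 / cylRadius p.2 * (f p.1 p.2 * f p.1 p.2 * fderiv ℝ P p.2 (eR p.2))) ∂μ) -
        L ^ 2 * ((T / 2) * (-(2 * radialConst₂) * A)) := by
    rw [← vax1, ← integral_const_mul, ← integral_sub i4 (iax1.const_mul (L ^ 2))]
    refine integral_congr_ae (Eventually.of_forall fun p => ?_)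
    ring
  -- the junk integrand
  have i23 : Integrable (fun p : ℝ × EuclideanSpace ℝ (Fin 3) => (-1 - p.1) / T * ((f p.1 p.2 * f p.1 p.2 - L ^ 2) * (Δ P) p.2)
      + (-1 - p.1) / T * ((f p.1 p.2 * f p.1 p.2 - L ^ 2) * fderiv ℝ P p.2 (b p.1 p.2))) μ := i2.add i3
  have iJ : Integrable (fun p : ℝ × EuclideanSpace ℝ (Fin 3) => (-1 - p.1) / T *
      ((f p.1 p.2 * f p.1 p.2 - L ^ 2) * ((Δ P) p.2 + fderiv ℝ P p.2 (b p.1 p.2) +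
        2 / cylRadius p.2 * fderiv ℝ P p.2 (eR p.2)))) μ := by
    refine (i23.add iaxG).congr (Eventually.of_forall fun p => ?_)
    simp only [Pi.add_apply]
    ring
  have vJ : ∫ p, (-1 - p.1) / T * ((f p.1 p.2 * f p.1 p.2 - L ^ 2) * ((Δ P) p.2 + fderiv ℝ P p.2 (b p.1 p.2) +
        2 / cylRadius p.2 * fderiv ℝ P p.2 (eR p.2))) ∂μ =
      (∫ p, (-1 - p.1) / T * ((f p.1 p.2 * f p.1 p.2 - L ^ 2) * (Δ P) p.2) ∂μ)
      + (∫ p, (-1 - p.1) / T * ((f p.1 p.2 * f p.1 p.2 - L ^ 2) * fderiv ℝ P p.2 (b p.1 p.2)) ∂μ)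
      + ∫ p, (-1 - p.1) / T * (2 / cylRadius p.2 * ((f p.1 p.2 * f p.1 p.2 - L ^ 2) * fderiv ℝ P p.2 (eR p.2))) ∂μ := by
    rw [← integral_add i2 i3, ← integral_add i23 iaxG]
    refine integral_congr_ae (Eventually.of_forall fun p => ?_)
    ring
  -- the time terms
  have iPμ : Integrable (fun p : ℝ × EuclideanSpace ℝ (Fin 3) => P p.2) μ := by
    have h : Integrable (fun p : ℝ × EuclideanSpace ℝ (Fin 3) => (1 : ℝ) * P p.2) μ :=
      Integrable.mul_prod (f := fun _ : ℝ => (1 : ℝ)) (integrableOn_const (C := (1 : ℝ)) measure_Ioc_lt_top.ne) hPint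
    exact h.congr (Eventually.of_forall fun p => one_mul _)
  have vPμ : ∫ p, P p.2 ∂μ = T * ∫ y, P y := by
    have h := integral_prod_mul (μ := volume.restrict (Ioc (-1 - T) (-1))) (ν := (volume : Measure (EuclideanSpace ℝ (Fin 3))))
      (fun _ : ℝ => (1 : ℝ)) P
    simp only [one_mul] at h
    rw [hμdef, h, setIntegral_const, Real.volume_real_Ioc_of_le (by linarith), smul_eq_mul, mul_one]
    ring
  have hζd' : ∀ s, deriv (fun s : ℝ => (-1 - s) / T) s = -(1 / T) := fun s => by rw [hζd]
  have iPμ' : Integrable (fun p : ℝ × EuclideanSpace ℝ (Fin 3) => L ^ 2 / T * P p.2) μ := iPμ.const_mul _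
  have iTG : Integrable (fun p : ℝ × EuclideanSpace ℝ (Fin 3) => 1 / T * ((f p.1 p.2 * f p.1 p.2 - L ^ 2) * P p.2)) μ := by
    refine ((i5.neg).sub iPμ').congr (Eventually.of_forall fun p => ?_)
    simp only [Pi.sub_apply, Pi.neg_apply, hζd']
    ring
  have vI5 : ∫ p, deriv (fun s : ℝ => (-1 - s) / T) p.1 * (f p.1 p.2 * f p.1 p.2 * P p.2) ∂μ =
      -(∫ p, 1 / T * ((f p.1 p.2 * f p.1 p.2 - L ^ 2) * P p.2) ∂μ) - L ^ 2 * ∫ y, P y := by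
    have i5n : Integrable (fun p : ℝ × EuclideanSpace ℝ (Fin 3) =>
        -(deriv (fun s : ℝ => (-1 - s) / T) p.1 * (f p.1 p.2 * f p.1 p.2 * P p.2))) μ := i5.neg
    have h1 : ∫ p, 1 / T * ((f p.1 p.2 * f p.1 p.2 - L ^ 2) * P p.2) ∂μ =
        (∫ p, -(deriv (fun s : ℝ => (-1 - s) / T) p.1 * (f p.1 p.2 * f p.1 p.2 * P p.2)) ∂μ) -
          ∫ p, L ^ 2 / T * P p.2 ∂μ := by
      rw [← integral_sub i5n iPμ']
      refine integral_congr_ae (Eventually.of_forall fun p => ?_)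
      simp only [hζd']
      ring
    rw [h1, integral_neg, integral_const_mul, vPμ]
    field_simp
    ring
  -- the initial term
  have hfa : Continuous (f (-1 - T)) := (hf (-1 - T) (by linarith)).continuous
  have iGa : Integrable fun y => (f (-1 - T) y * f (-1 - T) y - L ^ 2) * P y :=
    (((hfa.mul hfa).sub continuous_const).mul hP2.continuous).integrable_of_hasCompactSupport hPc.mul_left
  have vY : ∫ y, f (-1 - T) y * f (-1 - T) y * P y = (∫ y, (f (-1 - T) y * f (-1 - T) y - L ^ 2) * P y) + L ^ 2 * ∫ y, P y := by
    rw [← integral_const_mul, ← integral_add iGa (hPint.const_mul _)]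
    refine integral_congr_ae (Eventually.of_forall fun y => ?_)
    ring
  -- the dissipation is nonnegative
  have hDiss : 0 ≤ ∫ p, (-1 - p.1) / T * ((∑ i, (fderiv ℝ (f p.1) p.2 ((EuclideanSpace.basisFun (Fin 3) ℝ) i)) ^ 2) * P p.2) ∂μ := by
    refine integral_nonneg_of_ae ((ae_slab_mem_and_cylRadius_ne_zero (-1 - T) (-1)).mono fun p hp => ?_)
    have h1 : 0 ≤ (-1 - p.1) / T := (hζ01 p.1 hp.1).1
    exact mul_nonneg h1 (mul_nonneg (Finset.sum_nonneg fun i _ => sq_nonneg _) (hP01 p.2).1)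
  -- assemble
  refine ⟨iJ, iTG, iGa, ?_⟩
  have hzb : (-1 - (-1 : ℝ)) / T = 0 := by simp
  have hza : (-1 - (-1 - T)) / T = 1 := by
    rw [show (-1 - (-1 - T)) = T by ring]; exact div_self hT.ne'
  have hE' := hE
  simp only [hzb, hza] at hE'
  rw [vI5, vY] at hE'
  rw [vaxG] at vJ
  -- abbreviations for the real numbers involved
  have h1 := le_abs_self (∫ p, (-1 - p.1) / T * ((f p.1 p.2 * f p.1 p.2 - L ^ 2) * ((Δ P) p.2 + fderiv ℝ P p.2 (b p.1 p.2) +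
        2 / cylRadius p.2 * fderiv ℝ P p.2 (eR p.2))) ∂μ)
  have h2 := neg_abs_le (∫ p, 1 / T * ((f p.1 p.2 * f p.1 p.2 - L ^ 2) * P p.2) ∂μ)
  have h3 := le_abs_self (∫ y, (f (-1 - T) y * f (-1 - T) y - L ^ 2) * P y)
  have h4 : radialConst₂ * L ^ 2 * (2 * R) * T ≤ radialConst₂ * L ^ 2 * A * T := by
    have : 0 ≤ radialConst₂ * L ^ 2 * T := by positivity
    nlinarith [hA2R, this]
  nlinarith [hE', hDiss, vJ, h1, h2, h3, h4, hc₂]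

end EnergyIneq

/-! ### The bounds of the junk, time and initial terms through the envelope -/

section Bounds

variable {f : ℝ → EuclideanSpace ℝ (Fin 3) → ℝ} {b : ℝ → EuclideanSpace ℝ (Fin 3) → EuclideanSpace ℝ (Fin 3)}
  {Cb M T R r₀ r₁ K₁ E L B₂ : ℝ}

/-- The weight `Ψ = χ_R w_{r₀}`, its gradient and its Laplacian vanish off the closed ball of
radius `√2 R`. [folklore] -/
theorem productWeight_derivs_eq_zero (hR : 0 < R) {x : EuclideanSpace ℝ (Fin 3)}
    (hx : x ∉ closedBall (0 : EuclideanSpace ℝ (Fin 3)) (Real.sqrt 2 * R)) :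
    (fun y : EuclideanSpace ℝ (Fin 3) => Real.smoothTransition (2 - ‖y‖ ^ 2 / R ^ 2) ^ 2 *
        (r₀ ^ 2 / (r₀ ^ 2 + (y 0 ^ 2 + y 1 ^ 2)))) x = 0 ∧
    fderiv ℝ (fun y : EuclideanSpace ℝ (Fin 3) => Real.smoothTransition (2 - ‖y‖ ^ 2 / R ^ 2) ^ 2 *
        (r₀ ^ 2 / (r₀ ^ 2 + (y 0 ^ 2 + y 1 ^ 2)))) x = 0 ∧
    Δ (fun y : EuclideanSpace ℝ (Fin 3) => Real.smoothTransition (2 - ‖y‖ ^ 2 / R ^ 2) ^ 2 *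
        (r₀ ^ 2 / (r₀ ^ 2 + (y 0 ^ 2 + y 1 ^ 2)))) x = 0 := by
  have hsub : tsupport (fun y : EuclideanSpace ℝ (Fin 3) => Real.smoothTransition (2 - ‖y‖ ^ 2 / R ^ 2) ^ 2 *
      (r₀ ^ 2 / (r₀ ^ 2 + (y 0 ^ 2 + y 1 ^ 2)))) ⊆ closedBall (0 : EuclideanSpace ℝ (Fin 3)) (Real.sqrt 2 * R) :=
    (tsupport_mul_subset_left (f := fun y : EuclideanSpace ℝ (Fin 3) => Real.smoothTransition (2 - ‖y‖ ^ 2 / R ^ 2) ^ 2)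
      (g := fun y : EuclideanSpace ℝ (Fin 3) => r₀ ^ 2 / (r₀ ^ 2 + (y 0 ^ 2 + y 1 ^ 2)))).trans
      (tsupport_sqBallCutoff_subset hR)
  exact weight_derivs_eq_zero_of_notMem (fun h => hx (hsub h))

/-- **The junk terms are bounded through the envelope** (Lei–Ren–Zhang 2019, §4 Steps 3–5, the
bounds (4.8)–(4.13) of `T₂, T₃, T₁₁–T₁₅, I₁`, in the present rendering): if
`|f² − L²| ≤ e(r)` on the time window, `‖b‖ ≤ C_b` and `|⟪b, e_r⟫| ≤ M`, then
`|∫∫ ζ (f² − L²)(ΔΨ + DΨ[b] + (2/r)∂ᵣΨ) dμ| ≤ (T/2) · 4R · c₂ ∫₀^∞ ρ e(ρ) h(ρ) dρ`, `h` the pointwise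
bound of `abs_junk_productWeight_le`. [cite: LeiRenZhang2019, §4 Steps 3–5, (4.8)–(4.13) (arXiv pp. 11–12)] -/
theorem swirl_rate_junk_le (hT : 0 < T) (hR : 0 < R) (hr₀ : 0 < r₀) (hr₁ : 0 < r₁) (hK₁ : 0 ≤ K₁) (hE : 0 ≤ E)
    (hCb : 0 ≤ Cb) (hM : 0 ≤ M) (hB₂ : 0 ≤ B₂)
    (hΔΘ : ∀ x : EuclideanSpace ℝ (Fin 3),
      |Δ (fun y : EuclideanSpace ℝ (Fin 3) => Real.smoothTransition (2 - ‖y‖ ^ 2 / R ^ 2) ^ 2) x| ≤ B₂ / R ^ 2)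
    (hbB : ∀ t < 0, ∀ x, ‖b t x‖ ≤ Cb) (hbr : ∀ t < 0, ∀ x, |⟪b t x, eR x⟫| ≤ M)
    (hG : ∀ s ∈ Ioc (-1 - T) (-1), ∀ x : EuclideanSpace ℝ (Fin 3),
      |f s x * f s x - L ^ 2| ≤ (if cylRadius x ≤ r₁ then K₁ else E / cylRadius x))
    (hint : Integrable (fun p : ℝ × EuclideanSpace ℝ (Fin 3) => (-1 - p.1) / T *
        ((f p.1 p.2 * f p.1 p.2 - L ^ 2) *
          (Δ (fun y : EuclideanSpace ℝ (Fin 3) => Real.smoothTransition (2 - ‖y‖ ^ 2 / R ^ 2) ^ 2 *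
              (r₀ ^ 2 / (r₀ ^ 2 + (y 0 ^ 2 + y 1 ^ 2)))) p.2
          + fderiv ℝ (fun y : EuclideanSpace ℝ (Fin 3) => Real.smoothTransition (2 - ‖y‖ ^ 2 / R ^ 2) ^ 2 *
              (r₀ ^ 2 / (r₀ ^ 2 + (y 0 ^ 2 + y 1 ^ 2)))) p.2 (b p.1 p.2)
          + 2 / cylRadius p.2 * fderiv ℝ (fun y : EuclideanSpace ℝ (Fin 3) =>
              Real.smoothTransition (2 - ‖y‖ ^ 2 / R ^ 2) ^ 2 * (r₀ ^ 2 / (r₀ ^ 2 + (y 0 ^ 2 + y 1 ^ 2)))) p.2 (eR p.2))))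
      ((volume.restrict (Ioc (-1 - T) (-1))).prod (volume : Measure (EuclideanSpace ℝ (Fin 3))))) :
    |∫ p, (-1 - p.1) / T *
        ((f p.1 p.2 * f p.1 p.2 - L ^ 2) *
          (Δ (fun y : EuclideanSpace ℝ (Fin 3) => Real.smoothTransition (2 - ‖y‖ ^ 2 / R ^ 2) ^ 2 *
              (r₀ ^ 2 / (r₀ ^ 2 + (y 0 ^ 2 + y 1 ^ 2)))) p.2
          + fderiv ℝ (fun y : EuclideanSpace ℝ (Fin 3) => Real.smoothTransition (2 - ‖y‖ ^ 2 / R ^ 2) ^ 2 *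
              (r₀ ^ 2 / (r₀ ^ 2 + (y 0 ^ 2 + y 1 ^ 2)))) p.2 (b p.1 p.2)
          + 2 / cylRadius p.2 * fderiv ℝ (fun y : EuclideanSpace ℝ (Fin 3) =>
              Real.smoothTransition (2 - ‖y‖ ^ 2 / R ^ 2) ^ 2 * (r₀ ^ 2 / (r₀ ^ 2 + (y 0 ^ 2 + y 1 ^ 2)))) p.2 (eR p.2)))
        ∂((volume.restrict (Ioc (-1 - T) (-1))).prod (volume : Measure (EuclideanSpace ℝ (Fin 3))))| ≤
      (T / 2) * ((4 * R) * (radialConst₂ * ∫ ρ in Ioi (0 : ℝ), ρ * ((if ρ ≤ r₁ then K₁ else E / ρ) *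
        (8 * r₀ ^ 2 / (r₀ ^ 2 + ρ ^ 2) ^ 2
          + (B₂ / R ^ 2 + (4 * Real.sqrt 2 * smoothTransitionC2Bound) * Cb / R) * (r₀ ^ 2 / (r₀ ^ 2 + ρ ^ 2))
          + (4 * r₀ ^ 2 * (4 * Real.sqrt 2 * smoothTransitionC2Bound) / R + 2 * r₀ ^ 2 * M) * ρ / (r₀ ^ 2 + ρ ^ 2) ^ 2
          + 2 * (4 * Real.sqrt 2 * smoothTransitionC2Bound) / R * (r₀ ^ 2 / (r₀ ^ 2 + ρ ^ 2)) / ρ)))) := by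
  set B₁ : ℝ := 4 * Real.sqrt 2 * smoothTransitionC2Bound with hB₁def
  have hB₁ : 0 ≤ B₁ := by have := smoothTransitionC2Bound_nonneg; positivity
  have hDΘ : ∀ x : EuclideanSpace ℝ (Fin 3),
      ‖fderiv ℝ (fun y : EuclideanSpace ℝ (Fin 3) => Real.smoothTransition (2 - ‖y‖ ^ 2 / R ^ 2) ^ 2) x‖ ≤ B₁ / R :=
    fun x => norm_fderiv_sqBallCutoff_le_const hR x
  obtain ⟨hrad, -⟩ := radial_junk_integral_le (B₁ := B₁) hr₀ hr₁ hK₁ hE hR hB₁ hB₂ hCb hM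
  obtain ⟨hgI, hgv⟩ := integrable_and_integral_indicator_abs_le (c := 2 * R) (by positivity)
  obtain ⟨-, -, -, -, hζ01, hζi, hζint⟩ := timeProfile_props hT
  have h := abs_integral_slab_le_of_bound hint hrad hgI hζi ?_
  · rw [hζint, hgv, show (2 * (2 * R) : ℝ) = 4 * R by ring] at h
    exact h
  -- the pointwise bound
  refine (ae_slab_mem_and_cylRadius_ne_zero (-1 - T) (-1)).mono fun p hp => ?_
  have hs : p.1 ∈ Ioc (-1 - T) (-1) := hp.1
  have hs0 : p.1 < 0 := lt_of_le_of_lt hs.2 (by norm_num)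
  have hζ0 : 0 ≤ (-1 - p.1) / T := (hζ01 p.1 hs).1
  rw [abs_mul, abs_of_nonneg hζ0, abs_mul]
  refine mul_le_mul_of_nonneg_left ?_ hζ0
  have hGp := hG p.1 hs p.2
  have henv0 : 0 ≤ (if cylRadius p.2 ≤ r₁ then K₁ else E / cylRadius p.2) := by
    split_ifs
    · exact hK₁
    · exact div_nonneg hE (cylRadius_nonneg _)
  by_cases hx : p.2 ∈ closedBall (0 : EuclideanSpace ℝ (Fin 3)) (Real.sqrt 2 * R)
  · obtain ⟨-, hz⟩ := cylRadius_le_and_abs_le_of_mem_closedBall hR hx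
    have hmem : p.2 2 ∈ Icc (-(2 * R)) (2 * R) := abs_le.1 hz
    have hind : (Icc (-(2 * R)) (2 * R)).indicator (fun _ => (1 : ℝ)) (p.2 2) = 1 :=
      Set.indicator_of_mem hmem (fun _ => (1 : ℝ))
    rw [hind, mul_one]
    have hjunk := abs_junk_productWeight_le (r₀ := r₀) (B₂ := B₂) (Cb := Cb) (M := M) hr₀ hR hB₁ hDΘ hΔΘ p.2 (b p.1 p.2)
      (hbB p.1 hs0 p.2) (hbr p.1 hs0 p.2)
    exact mul_le_mul hGp hjunk (abs_nonneg _) henv0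
  · obtain ⟨-, hD0, hΔ0⟩ := productWeight_derivs_eq_zero (r₀ := r₀) hR hx
    rw [hD0, hΔ0]
    have hzero : ((0 : EuclideanSpace ℝ (Fin 3) →L[ℝ] ℝ) (b p.1 p.2) : ℝ) = 0 := rfl
    have hzero' : ((0 : EuclideanSpace ℝ (Fin 3) →L[ℝ] ℝ) (eR p.2) : ℝ) = 0 := rfl
    rw [hzero, hzero', mul_zero, add_zero, add_zero, abs_zero, mul_zero]
    have hr := cylRadius_nonneg p.2
    refine mul_nonneg (mul_nonneg henv0 ?_) (Set.indicator_nonneg (fun _ _ => zero_le_one) _)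
    positivity

/-- The pointwise bound `|(f² − L²) Ψ| ≤ e(r) · r₀²/(r₀² + r²) · 1_{|x₂| ≤ 2R}` for the weight
`Ψ = χ_R w_{r₀}` (`0 ≤ χ_R ≤ 1`, supported in `{|x| ≤ √2R} ⊆ {|x₂| ≤ 2R}`). [folklore] -/
theorem abs_mul_productWeight_le (hR : 0 < R) (hr₀ : 0 < r₀) (hK₁ : 0 ≤ K₁) (hE : 0 ≤ E) {g : ℝ}
    (x : EuclideanSpace ℝ (Fin 3)) (hg : |g| ≤ (if cylRadius x ≤ r₁ then K₁ else E / cylRadius x)) :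
    |g * (Real.smoothTransition (2 - ‖x‖ ^ 2 / R ^ 2) ^ 2 * (r₀ ^ 2 / (r₀ ^ 2 + (x 0 ^ 2 + x 1 ^ 2))))| ≤
      (if cylRadius x ≤ r₁ then K₁ else E / cylRadius x) * (r₀ ^ 2 / (r₀ ^ 2 + cylRadius x ^ 2)) *
        (Icc (-(2 * R)) (2 * R)).indicator (fun _ => (1 : ℝ)) (x 2) := by
  have henv0 : 0 ≤ (if cylRadius x ≤ r₁ then K₁ else E / cylRadius x) := by
    split_ifs
    · exact hK₁
    · exact div_nonneg hE (cylRadius_nonneg _)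
  obtain ⟨hw0, hw1⟩ := radialWeight_pos_le_one hr₀ x
  have hΘ0 := sqBallCutoff_nonneg R x
  have hΘ1 := sqBallCutoff_le_one R x
  have hW : 0 ≤ r₀ ^ 2 / (r₀ ^ 2 + cylRadius x ^ 2) := by positivity
  by_cases hx : x ∈ closedBall (0 : EuclideanSpace ℝ (Fin 3)) (Real.sqrt 2 * R)
  · obtain ⟨-, hz⟩ := cylRadius_le_and_abs_le_of_mem_closedBall hR hx
    have hmem : x 2 ∈ Icc (-(2 * R)) (2 * R) := abs_le.1 hz
    rw [Set.indicator_of_mem hmem (fun _ => (1 : ℝ)), mul_one, abs_mul, abs_mul, abs_of_nonneg hΘ0,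
      abs_of_nonneg hw0.le, radialWeight_eq_profile]
    calc |g| * (Real.smoothTransition (2 - ‖x‖ ^ 2 / R ^ 2) ^ 2 * (r₀ ^ 2 / (r₀ ^ 2 + cylRadius x ^ 2)))
        ≤ (if cylRadius x ≤ r₁ then K₁ else E / cylRadius x) * (1 * (r₀ ^ 2 / (r₀ ^ 2 + cylRadius x ^ 2))) :=
          mul_le_mul hg (mul_le_mul_of_nonneg_right hΘ1 hW) (by positivity) henv0
      _ = (if cylRadius x ≤ r₁ then K₁ else E / cylRadius x) * (r₀ ^ 2 / (r₀ ^ 2 + cylRadius x ^ 2)) := by rw [one_mul]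
  · obtain ⟨hP0, -, -⟩ := productWeight_derivs_eq_zero (r₀ := r₀) hR hx
    simp only [] at hP0
    rw [hP0, mul_zero, abs_zero]
    exact mul_nonneg (mul_nonneg henv0 hW) (Set.indicator_nonneg (fun _ _ => zero_le_one) _)

/-- The radial integral `∫₀^∞ ρ e(ρ) r₀²/(r₀² + ρ²) dρ ≤ K₁ r₁² + E π r₀/2`, with integrability.
[folklore] -/
theorem radial_envelope_weight_le (hr₀ : 0 < r₀) (hr₁ : 0 < r₁) (hK₁ : 0 ≤ K₁) (hE : 0 ≤ E) :
    IntegrableOn (fun ρ : ℝ => ρ * ((if ρ ≤ r₁ then K₁ else E / ρ) * (r₀ ^ 2 / (r₀ ^ 2 + ρ ^ 2)))) (Ioi 0) ∧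
    ∫ ρ in Ioi (0 : ℝ), ρ * ((if ρ ≤ r₁ then K₁ else E / ρ) * (r₀ ^ 2 / (r₀ ^ 2 + ρ ^ 2))) ≤
      K₁ * r₁ * r₁ + E * (π * r₀ / 2) := by
  obtain ⟨hIW, hIWv⟩ := integrableOn_and_integral_Ioi_radialProfile hr₀
  have hWc : ContinuousOn (fun ρ : ℝ => r₀ ^ 2 / (r₀ ^ 2 + ρ ^ 2)) (Ioi 0) := by
    refine Continuous.continuousOn ?_
    have hD : ∀ ρ : ℝ, r₀ ^ 2 + ρ ^ 2 ≠ 0 := fun ρ => by positivity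
    fun_prop (disch := assumption)
  have hW0 : ∀ ρ ∈ Ioi (0 : ℝ), 0 ≤ r₀ ^ 2 / (r₀ ^ 2 + ρ ^ 2) := fun ρ _ => by positivity
  have hA : ∀ ρ ∈ Ioc (0 : ℝ) r₁, ρ * (r₀ ^ 2 / (r₀ ^ 2 + ρ ^ 2)) ≤ r₁ := by
    intro ρ hρ
    have hW1 : r₀ ^ 2 / (r₀ ^ 2 + ρ ^ 2) ≤ 1 := by
      rw [div_le_one (by positivity)]; nlinarith
    calc ρ * (r₀ ^ 2 / (r₀ ^ 2 + ρ ^ 2)) ≤ r₁ * 1 := mul_le_mul hρ.2 hW1 (hW0 ρ hρ.1) hr₁.le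
      _ = r₁ := mul_one _
  obtain ⟨hi, hv⟩ := integrableOn_and_setIntegral_mul_envelope_mul_le (E := E) hK₁ hE hr₁ hWc hW0 hIW hA
  refine ⟨hi, ?_⟩
  rw [hIWv] at hv
  exact hv

/-- **The time term is bounded through the envelope** (Lei–Ren–Zhang 2019, §4, the term `T₁₆` of
(4.5), p. 11: "`T₁₆ ≤ ½ ‖Γ² − 1‖_∞ R (R₀ r₀ + R₀ − r₀)`", in the present rendering):
`|∫∫ (1/T)(f² − L²) Ψ dμ| ≤ 4R · c₂ ∫₀^∞ ρ e(ρ) w(ρ) dρ`. [cite: LeiRenZhang2019, §4 Step 3, (4.5)–(4.6) (arXiv p. 11)] -/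
theorem swirl_rate_time_le (hT : 0 < T) (hR : 0 < R) (hr₀ : 0 < r₀) (hr₁ : 0 < r₁) (hK₁ : 0 ≤ K₁) (hE : 0 ≤ E)
    (hG : ∀ s ∈ Ioc (-1 - T) (-1), ∀ x : EuclideanSpace ℝ (Fin 3),
      |f s x * f s x - L ^ 2| ≤ (if cylRadius x ≤ r₁ then K₁ else E / cylRadius x))
    (hint : Integrable (fun p : ℝ × EuclideanSpace ℝ (Fin 3) => 1 / T * ((f p.1 p.2 * f p.1 p.2 - L ^ 2) *
        (Real.smoothTransition (2 - ‖p.2‖ ^ 2 / R ^ 2) ^ 2 * (r₀ ^ 2 / (r₀ ^ 2 + (p.2 0 ^ 2 + p.2 1 ^ 2))))))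
      ((volume.restrict (Ioc (-1 - T) (-1))).prod (volume : Measure (EuclideanSpace ℝ (Fin 3))))) :
    |∫ p, 1 / T * ((f p.1 p.2 * f p.1 p.2 - L ^ 2) *
          (Real.smoothTransition (2 - ‖p.2‖ ^ 2 / R ^ 2) ^ 2 * (r₀ ^ 2 / (r₀ ^ 2 + (p.2 0 ^ 2 + p.2 1 ^ 2)))))
        ∂((volume.restrict (Ioc (-1 - T) (-1))).prod (volume : Measure (EuclideanSpace ℝ (Fin 3))))| ≤
      (4 * R) * (radialConst₂ * ∫ ρ in Ioi (0 : ℝ), ρ * ((if ρ ≤ r₁ then K₁ else E / ρ) * (r₀ ^ 2 / (r₀ ^ 2 + ρ ^ 2)))) := by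
  obtain ⟨hrad, -⟩ := radial_envelope_weight_le (E := E) hr₀ hr₁ hK₁ hE
  obtain ⟨hgI, hgv⟩ := integrable_and_integral_indicator_abs_le (c := 2 * R) (by positivity)
  have hφ : IntegrableOn (fun _ : ℝ => 1 / T) (Ioc (-1 - T) (-1)) := integrableOn_const (C := 1 / T) measure_Ioc_lt_top.ne
  have h := abs_integral_slab_le_of_bound (φ := fun _ : ℝ => 1 / T) hint hrad hgI hφ ?_
  · rw [hgv, setIntegral_const, Real.volume_real_Ioc_of_le (by linarith), smul_eq_mul,
      show (-1 - (-1 - T)) * (1 / T) = 1 by field_simp; ring, one_mul, show (2 * (2 * R) : ℝ) = 4 * R by ring] at h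
    exact h
  refine (ae_slab_mem_and_cylRadius_ne_zero (-1 - T) (-1)).mono fun p hp => ?_
  rw [abs_mul, abs_of_nonneg (by positivity : (0 : ℝ) ≤ 1 / T)]
  refine mul_le_mul_of_nonneg_left ?_ (by positivity)
  exact abs_mul_productWeight_le hR hr₀ hK₁ hE p.2 (hG p.1 hp.1 p.2)

/-- **The initial term is bounded through the envelope** (Lei–Ren–Zhang 2019, §4, the term `T₁₇`
of (4.5)): `|∫ (f(−1−T)² − L²) Ψ dx| ≤ 4R · c₂ ∫₀^∞ ρ e(ρ) w(ρ) dρ`. [cite: LeiRenZhang2019, §4 Step 3, (4.5), (4.7) (arXiv p. 11)] -/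
theorem swirl_rate_initial_le (hR : 0 < R) (hr₀ : 0 < r₀) (hr₁ : 0 < r₁) (hK₁ : 0 ≤ K₁) (hE : 0 ≤ E) {a : ℝ}
    (hG : ∀ x : EuclideanSpace ℝ (Fin 3), |f a x * f a x - L ^ 2| ≤ (if cylRadius x ≤ r₁ then K₁ else E / cylRadius x))
    (hint : Integrable (fun y : EuclideanSpace ℝ (Fin 3) => (f a y * f a y - L ^ 2) *
        (Real.smoothTransition (2 - ‖y‖ ^ 2 / R ^ 2) ^ 2 * (r₀ ^ 2 / (r₀ ^ 2 + (y 0 ^ 2 + y 1 ^ 2)))))) :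
    |∫ y, (f a y * f a y - L ^ 2) *
          (Real.smoothTransition (2 - ‖y‖ ^ 2 / R ^ 2) ^ 2 * (r₀ ^ 2 / (r₀ ^ 2 + (y 0 ^ 2 + y 1 ^ 2))))| ≤
      (4 * R) * (radialConst₂ * ∫ ρ in Ioi (0 : ℝ), ρ * ((if ρ ≤ r₁ then K₁ else E / ρ) * (r₀ ^ 2 / (r₀ ^ 2 + ρ ^ 2)))) := by
  obtain ⟨hrad, -⟩ := radial_envelope_weight_le (E := E) hr₀ hr₁ hK₁ hE
  obtain ⟨hgI, hgv⟩ := integrable_and_integral_indicator_abs_le (c := 2 * R) (by positivity)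
  have h := abs_integral_le_of_bound_cyl hint hrad hgI (Eventually.of_forall fun x => abs_mul_productWeight_le hR hr₀ hK₁ hE x (hG x))
  rw [hgv, show (2 * (2 * R) : ℝ) = 4 * R by ring] at h
  exact h

end Bounds

/-! ### The contradiction -/

section Contradiction

variable {f : ℝ → EuclideanSpace ℝ (Fin 3) → ℝ} {b : ℝ → EuclideanSpace ℝ (Fin 3) → EuclideanSpace ℝ (Fin 3)}
  {Cf Cb M L ε R₀ : ℝ}

set_option maxHeartbeats 1600000 in
/-- **Lei–Ren–Zhang 2019, Theorem 1.2, the core: the rate condition with a non-zero limit is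
impossible** (arXiv:1902.11229, §4, Steps 1–6, pp. 10–12: "Suppose for contradiction that
`lim sup_{r→∞} Γ = 0` is false … inequality (4.14) is impossible when `R` is sufficiently large
and `T ≫ R₀r₀`, `R₀ ≫ r₀` and `ε` is sufficiently small. Hence `lim_{r→∞} Γ = 0` uniformly").
Let `f` be an axisymmetric scalar on `(−∞, 0) × ℝ³` with `C²` slices, `f`, `∇f`, `Δf` jointly
continuous, vanishing on the axis, `|f| ≤ C_f`, solving the swirl equation
`fₜ + b·∇f + (2/r)∂ᵣf = Δf` (time-integrated off the axis, KNSS 2009, (5.10)) with a jointly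
measurable, divergence-free `C¹` drift `b`, `‖b‖ ≤ C_b`, whose radial component satisfies
`|⟪b, e_r⟫| ≤ M`. If for some `L ≠ 0`, `R₀` and `0 ≤ ε` with `ε (M + 1) ≤ 1/16` the rate condition
`|f² − L²| ≤ ε L² / r` holds whenever `r ≥ R₀` (all `z`, all `t < 0`), then `False`. The smallness
`ε (M + 1) ≤ 1/16` is the printed "`ε₀ ∈ (0,1)` depending only on `‖v‖_∞`" (only the radial drift
enters: the main error term is `ε L² M` against the axis source `L²`, Step 5, `I₁`). Proof:
`swirl_rate_energy_ineq` with `T = R`, the bounds `swirl_rate_junk_le`, `swirl_rate_time_le`,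
`swirl_rate_initial_le`, `radial_junk_integral_le`, the choice `r₀ = 13 + 16(8K₁r₁² + 2MK₁r₁³)/L²`
(`K₁ = C_f² + L²`, `r₁ = max R₀ 1`) making the `R`-independent junk `≤ 3L²/16`, and `R → ∞`.
[cite: LeiRenZhang2019, Thm 1.2 (arXiv p. 4) and §4 Steps 1–6, (4.1)–(4.14) (pp. 10–12)] -/
theorem swirl_rate_contradiction
    (hf : ∀ t < 0, ContDiff ℝ 2 (f t))
    (hfc : ContinuousOn (uncurry f) (Iio 0 ×ˢ univ))
    (hfD : ContinuousOn (fun p : ℝ × EuclideanSpace ℝ (Fin 3) => fderiv ℝ (f p.1) p.2) (Iio 0 ×ˢ univ))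
    (hfΔ : ContinuousOn (fun p : ℝ × EuclideanSpace ℝ (Fin 3) => (Δ (f p.1)) p.2) (Iio 0 ×ˢ univ))
    (hax : ∀ t < 0, IsAxisymmetricScalar (f t))
    (h0 : ∀ t < 0, ∀ x, cylRadius x = 0 → f t x = 0)
    (hfB : ∀ t < 0, ∀ x, |f t x| ≤ Cf)
    (hbm : Measurable (uncurry b))
    (hb1 : ∀ t < 0, ContDiff ℝ 1 (b t)) (hbdiv : ∀ t < 0, VectorCalculus.IsDivFree (b t))
    (hbB : ∀ t < 0, ∀ x, ‖b t x‖ ≤ Cb) (hbr : ∀ t < 0, ∀ x, |⟪b t x, eR x⟫| ≤ M)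
    (heq : ∀ x, cylRadius x ≠ 0 → ∀ s t : ℝ, s ≤ t → t < 0 →
      f t x - f s x = ∫ τ in s..t, swirlEqnIntegrand f b τ x)
    (hL : L ≠ 0) (hε : 0 ≤ ε) (hεM : ε * (M + 1) ≤ 1 / 16)
    (hrate : ∀ t < 0, ∀ x, R₀ ≤ cylRadius x → |f t x ^ 2 - L ^ 2| ≤ ε * L ^ 2 / cylRadius x) : False := by
  -- signs of the constants
  have hCf : 0 ≤ Cf := (abs_nonneg _).trans (hfB (-1) (by norm_num) 0)
  have hCb : 0 ≤ Cb := (norm_nonneg _).trans (hbB (-1) (by norm_num) 0)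
  have hM : 0 ≤ M := (abs_nonneg _).trans (hbr (-1) (by norm_num) 0)
  have hL2 : 0 < L ^ 2 := by positivity
  have hεM' : ε * M ≤ 1 / 16 := by nlinarith
  have hε' : ε ≤ 1 / 16 := by nlinarith
  have hCS := smoothTransitionC2Bound_nonneg
  have hc₂ := radialConst₂_pos
  have hπ3 : π < 3.15 := Real.pi_lt_d2
  have hπ0 : 0 < π := Real.pi_pos
  -- the envelope
  obtain ⟨r₁, hr₁⟩ : ∃ r₁ : ℝ, r₁ = max R₀ 1 := ⟨_, rfl⟩
  have hr₁1 : 1 ≤ r₁ := hr₁ ▸ le_max_right _ _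
  have hr₁0 : 0 < r₁ := by linarith
  have hr₁R : R₀ ≤ r₁ := hr₁ ▸ le_max_left _ _
  obtain ⟨K₁, hK₁⟩ : ∃ K₁ : ℝ, K₁ = Cf ^ 2 + L ^ 2 := ⟨_, rfl⟩
  have hK₁0 : 0 ≤ K₁ := by rw [hK₁]; positivity
  obtain ⟨E, hEdef⟩ : ∃ E : ℝ, E = ε * L ^ 2 := ⟨_, rfl⟩
  have hE0 : 0 ≤ E := by rw [hEdef]; positivity
  have hG : ∀ s < 0, ∀ x : EuclideanSpace ℝ (Fin 3),
      |f s x * f s x - L ^ 2| ≤ (if cylRadius x ≤ r₁ then K₁ else E / cylRadius x) := by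
    intro s hs x
    by_cases hx : cylRadius x ≤ r₁
    · rw [if_pos hx, hK₁]
      have h1 := abs_le.1 (hfB s hs x)
      have h2 : f s x * f s x ≤ Cf ^ 2 := by nlinarith
      have h3 : 0 ≤ f s x * f s x := mul_self_nonneg _
      rw [abs_le]; constructor <;> nlinarith
    · rw [if_neg hx, hEdef]
      have hr : R₀ ≤ cylRadius x := by linarith [not_le.1 hx]
      have h := hrate s hs x hr
      rw [sq] at h
      exact h
  -- the cut-off constants
  obtain ⟨B₂, hB₂0, hB₂⟩ := exists_bound_laplacian_sqBallCutoff
  obtain ⟨B₁, hB₁⟩ : ∃ B₁ : ℝ, B₁ = 4 * Real.sqrt 2 * smoothTransitionC2Bound := ⟨_, rfl⟩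
  have hB₁0 : 0 ≤ B₁ := by rw [hB₁]; positivity
  -- the inner radius `r₀`
  obtain ⟨X, hX⟩ : ∃ X : ℝ, X = 8 * K₁ * r₁ ^ 2 + 2 * M * K₁ * r₁ ^ 3 := ⟨_, rfl⟩
  have hX0 : 0 ≤ X := by rw [hX]; positivity
  obtain ⟨r₀, hr₀⟩ : ∃ r₀ : ℝ, r₀ = 13 + 16 * X / L ^ 2 := ⟨_, rfl⟩
  have hr₀13 : 13 ≤ r₀ := by
    have : 0 ≤ 16 * X / L ^ 2 := by positivity
    rw [hr₀]; linarith
  have hr₀0 : 0 < r₀ := by linarith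
  have hr₀1 : 1 ≤ r₀ := by linarith
  -- the `R`-independent junk `J₀ ≤ 3L²/16`
  obtain ⟨J₀, hJ₀⟩ : ∃ J₀ : ℝ, J₀ = K₁ * r₁ * (8 * r₁ / r₀ ^ 2 + 2 * r₀ ^ 2 * M * r₁ ^ 2 / r₀ ^ 4) + E * (4 * π / r₀ + 2 * r₀ ^ 2 * M / (2 * r₀ ^ 2)) :=
    ⟨_, rfl⟩
  have hJ₀le : J₀ ≤ 3 * L ^ 2 / 16 := by
    have e1 : J₀ = X / r₀ ^ 2 + 4 * π * E / r₀ + E * M := by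
      rw [hJ₀, hX]; field_simp; ring
    have t1 : X / r₀ ^ 2 ≤ L ^ 2 / 16 := by
      have h1 : X / r₀ ^ 2 ≤ X / r₀ := by
        refine div_le_div_of_nonneg_left hX0 hr₀0 ?_
        nlinarith
      have h2 : X / r₀ ≤ L ^ 2 / 16 := by
        rw [div_le_div_iff₀ hr₀0 (by norm_num : (0:ℝ) < 16)]
        have : 16 * X / L ^ 2 * L ^ 2 = 16 * X := by field_simp
        have hr₀' : r₀ * L ^ 2 = 13 * L ^ 2 + 16 * X := by rw [hr₀]; field_simp
        nlinarith [this, hr₀']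
      exact h1.trans h2
    have t2 : 4 * π * E / r₀ ≤ L ^ 2 / 16 := by
      have h1 : 4 * π * E / r₀ ≤ 4 * π * E / 13 := div_le_div_of_nonneg_left (by positivity) (by norm_num) hr₀13
      have h2 : 4 * π * E / 13 ≤ L ^ 2 / 16 := by
        rw [hEdef, div_le_div_iff₀ (by norm_num : (0:ℝ) < 13) (by norm_num : (0:ℝ) < 16)]
        nlinarith [mul_le_mul_of_nonneg_left hε' (by positivity : (0:ℝ) ≤ π * L ^ 2)]
      exact h1.trans h2
    have t3 : E * M ≤ L ^ 2 / 16 := by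
      rw [hEdef]; nlinarith
    rw [e1]; linarith
  -- the `R`-dependent junk constant `J₁` and the time constant `Kw`
  obtain ⟨J₁, hJ₁⟩ : ∃ J₁ : ℝ, J₁ = (B₂ + B₁ * Cb) * (K₁ * r₁ ^ 2 + E * (π * r₀ / 2)) +
    (K₁ * r₁ * ((4 * r₀ ^ 2 * B₁) * r₁ ^ 2 / r₀ ^ 4) + E * ((4 * r₀ ^ 2 * B₁) / (2 * r₀ ^ 2))
      + 2 * B₁ * (K₁ * r₁ + E / r₁ * (π * r₀ / 2))) := ⟨_, rfl⟩
  have hJ₁0 : 0 ≤ J₁ := by rw [hJ₁]; positivity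
  obtain ⟨Kw, hKw⟩ : ∃ Kw : ℝ, Kw = K₁ * r₁ * r₁ + E * (π * r₀ / 2) := ⟨_, rfl⟩
  have hKw0 : 0 ≤ Kw := by rw [hKw]; positivity
  -- the box size
  obtain ⟨R, hRdef⟩ : ∃ R : ℝ, R = 16 * (J₁ + 4 * Kw) / (13 * L ^ 2) + 1 := ⟨_, rfl⟩
  have hR1 : 1 ≤ R := by
    have : 0 ≤ 16 * (J₁ + 4 * Kw) / (13 * L ^ 2) := by positivity
    rw [hRdef]; linarith
  have hR : 0 < R := by linarith
  -- the energy inequality with `T = R`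
  obtain ⟨iJ, iTG, iGa, hineq⟩ := swirl_rate_energy_ineq (T := R) (R := R) (r₀ := r₀) (L := L) hR hR hr₀0
    hf hfc hfD hfΔ hax h0 hbm hb1 hbdiv hbB heq
  have hG' : ∀ s ∈ Ioc (-1 - R) (-1), ∀ x : EuclideanSpace ℝ (Fin 3),
      |f s x * f s x - L ^ 2| ≤ (if cylRadius x ≤ r₁ then K₁ else E / cylRadius x) :=
    fun s hs x => hG s (lt_of_le_of_lt hs.2 (by norm_num)) x
  have hJ := swirl_rate_junk_le (E := E) hR hR hr₀0 hr₁0 hK₁0 hE0 hCb hM hB₂0 (hB₂ R hR) hbB hbr hG' iJ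
  have hTG := swirl_rate_time_le (E := E) hR hR hr₀0 hr₁0 hK₁0 hE0 hG' iTG
  have hGa := swirl_rate_initial_le (E := E) hR hr₀0 hr₁0 hK₁0 hE0 (a := -1 - R) (fun x => hG (-1 - R) (by linarith) x) iGa
  obtain ⟨-, hradB⟩ := radial_junk_integral_le (B₁ := B₁) (B₂ := B₂) (Cb := Cb) (M := M) (E := E) (K₁ := K₁)
    hr₀0 hr₁0 hK₁0 hE0 hR hB₁0 hB₂0 hCb hM
  obtain ⟨-, hKwB⟩ := radial_envelope_weight_le (E := E) (K₁ := K₁) hr₀0 hr₁0 hK₁0 hE0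
  rw [← hB₁] at hJ
  rw [← hKw] at hKwB
  -- abbreviations
  set Jrad : ℝ := ∫ ρ in Ioi (0 : ℝ), ρ * ((if ρ ≤ r₁ then K₁ else E / ρ) *
      (8 * r₀ ^ 2 / (r₀ ^ 2 + ρ ^ 2) ^ 2
        + (B₂ / R ^ 2 + B₁ * Cb / R) * (r₀ ^ 2 / (r₀ ^ 2 + ρ ^ 2))
        + (4 * r₀ ^ 2 * B₁ / R + 2 * r₀ ^ 2 * M) * ρ / (r₀ ^ 2 + ρ ^ 2) ^ 2
        + 2 * B₁ / R * (r₀ ^ 2 / (r₀ ^ 2 + ρ ^ 2)) / ρ)) with hJrad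
  set KwI : ℝ := ∫ ρ in Ioi (0 : ℝ), ρ * ((if ρ ≤ r₁ then K₁ else E / ρ) * (r₀ ^ 2 / (r₀ ^ 2 + ρ ^ 2))) with hKwI
  clear_value Jrad KwI
  -- `L² R ≤ R Jrad + 4 KwI`
  have hKwI0 : 0 ≤ KwI := by
    have h := hTG
    have : 0 ≤ (4 * R) * (radialConst₂ * KwI) := (abs_nonneg _).trans h
    have h4 : 0 < 4 * R * radialConst₂ := by positivity
    nlinarith
  have hmain : L ^ 2 * R ≤ R * Jrad + 4 * KwI := by
    have h1 : radialConst₂ * L ^ 2 * (2 * R) * R ≤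
        (R / 2) * ((4 * R) * (radialConst₂ * Jrad)) + (4 * R) * (radialConst₂ * KwI) + (4 * R) * (radialConst₂ * KwI) := by
      linarith only [hineq, hJ, hTG, hGa]
    have h2 : radialConst₂ * L ^ 2 * (2 * R) * R = (2 * radialConst₂ * R) * (L ^ 2 * R) := by ring
    have h3 : (R / 2) * ((4 * R) * (radialConst₂ * Jrad)) + (4 * R) * (radialConst₂ * KwI) + (4 * R) * (radialConst₂ * KwI) =
        (2 * radialConst₂ * R) * (R * Jrad + 4 * KwI) := by ring
    rw [h2, h3] at h1
    exact le_of_mul_le_mul_left h1 (by positivity : (0:ℝ) < 2 * radialConst₂ * R)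
  -- `Jrad ≤ J₀ + J₁ / R`
  have hJradle : Jrad ≤ J₀ + J₁ / R := by
    refine hradB.trans ?_
    have hc₂' : B₂ / R ^ 2 + B₁ * Cb / R ≤ (B₂ + B₁ * Cb) / R := by
      have h1 : B₂ / R ^ 2 ≤ B₂ / R := div_le_div_of_nonneg_left hB₂0 hR (by nlinarith)
      rw [add_div]; linarith
    have hKw1 : 0 ≤ K₁ * r₁ ^ 2 + E * (π * r₀ / 2) := by positivity
    have hsplit : K₁ * r₁ * (8 * r₁ / r₀ ^ 2 + (B₂ / R ^ 2 + B₁ * Cb / R) * r₁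
          + (4 * r₀ ^ 2 * B₁ / R + 2 * r₀ ^ 2 * M) * r₁ ^ 2 / r₀ ^ 4)
        + E * (4 * π / r₀ + (B₂ / R ^ 2 + B₁ * Cb / R) * (π * r₀ / 2)
          + (4 * r₀ ^ 2 * B₁ / R + 2 * r₀ ^ 2 * M) / (2 * r₀ ^ 2))
        + 2 * B₁ / R * (K₁ * r₁ + E / r₁ * (π * r₀ / 2)) =
        J₀ + (B₂ / R ^ 2 + B₁ * Cb / R) * (K₁ * r₁ ^ 2 + E * (π * r₀ / 2))
          + (1 / R) * (K₁ * r₁ * ((4 * r₀ ^ 2 * B₁) * r₁ ^ 2 / r₀ ^ 4) + E * ((4 * r₀ ^ 2 * B₁) / (2 * r₀ ^ 2))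
            + 2 * B₁ * (K₁ * r₁ + E / r₁ * (π * r₀ / 2))) := by
      rw [hJ₀]; field_simp; ring
    rw [hsplit]
    have hJ₁eq : J₁ / R = (B₂ + B₁ * Cb) / R * (K₁ * r₁ ^ 2 + E * (π * r₀ / 2))
        + (1 / R) * (K₁ * r₁ * ((4 * r₀ ^ 2 * B₁) * r₁ ^ 2 / r₀ ^ 4) + E * ((4 * r₀ ^ 2 * B₁) / (2 * r₀ ^ 2))
          + 2 * B₁ * (K₁ * r₁ + E / r₁ * (π * r₀ / 2))) := by
      rw [hJ₁]; field_simp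
    rw [hJ₁eq]
    have hkey := mul_le_mul_of_nonneg_right hc₂' hKw1
    linarith only [hkey]
  have hKwle : KwI ≤ Kw := hKwB
  -- conclude
  have h1 : L ^ 2 * R ≤ R * (J₀ + J₁ / R) + 4 * Kw := by
    have := mul_le_mul_of_nonneg_left hJradle hR.le
    linarith only [hmain, this, hKwle]
  have h2 : R * (J₀ + J₁ / R) = R * J₀ + J₁ := by field_simp
  rw [h2] at h1
  have h3 : R * J₀ ≤ R * (3 * L ^ 2 / 16) := mul_le_mul_of_nonneg_left hJ₀le hR.le
  have h3' : R * (3 * L ^ 2 / 16) = 3 / 16 * (L ^ 2 * R) := by ring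
  rw [h3'] at h3
  have h4 : 13 * (L ^ 2 * R) ≤ 16 * (J₁ + 4 * Kw) := by linarith only [h1, h3]
  have h5 : R ≤ 16 * (J₁ + 4 * Kw) / (13 * L ^ 2) := by
    rw [le_div_iff₀ (by positivity)]
    have : R * (13 * L ^ 2) = 13 * (L ^ 2 * R) := by ring
    rw [this]; exact h4
  have h6 : 16 * (J₁ + 4 * Kw) / (13 * L ^ 2) < R := by rw [hRdef]; linarith only
  linarith only [h5, h6]

end Contradiction

end Literature.Analysis.FluidPDE

end
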